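import Literature.MathematicalPhysics.QuantumFieldTheory.BalabanImbrieJaffe1984to88.BIJ88RT52Restrictions
import Literature.MathematicalPhysics.QuantumFieldTheory.BalabanImbrieJaffe1984to88.BIJ88Eq531TranslLawCutoff
import Literature.MathematicalPhysics.QuantumFieldTheory.BalabanImbrieJaffe1984to88.BIJ88RT52BlockGauge

/-!
# `BalabanImbrieJaffe1984to88.BIJ88RT53TranslCut` — T. Bałaban, J. Imbrie, A. Jaffe, *Effective action and cluster properties of the
abelian Higgs model*, Commun. Math. Phys. **114** (1988) 257–315 [BalabanImbrieJaffe1988], Sect. 5.3 p. 280 [PDF 24], (5.3.1)/(5.3.6):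
**the density display of Sect. 5 AFTER THE FIRST GAUGE FIELD TRANSLATION WITH ITS CUT-OFF** — *"The first translation is done in
Λ₁^{(k)*}, and it removes the v-field from the δ-functions there. As in (3.24) we put u = u′(Λ₁^{(k)*}Q^{s*}v) (5.3.1) … δ_{Ax}(u) = δ_{Ax}(u′),
δ(v/Qu) = δ_{Λ₁^{(k)′*c}}(v/Qu) δ_{Λ₁^{(k)′*}}((e_k/2π)QA′) (5.3.6)"* — PROVED AT MEASURE LEVEL for the `ψ`-dependent display `IsRD` of
`BIJ88RT52Restrictions` (the shape of (5.1.1)/(5.2.8)): the translated display `IsRDT` (the integrand evaluated at `u′_Λ(u)·Q^{s*}(cut-off·v′)`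
with the `Λ`-components `v′` of the block field integrated FREELY against the Haar measure, the test function seeing `v′` on `Λ` and `Qu` off
`Λ` — exactly the δ-function structure *"∫du^{(k)} δ_{Ax}(u^{(k)}) δ_{Λ₁^{(k)′*c}}(v/Qu^{(k)}) δ_{Λ₁^{(k)′*}}((e_k/2π)QA^{(k)})"* of the first line
of (5.9.6) p. 297) holds for every density satisfying `IsRD` over a substitution-invariant `u`-law (`𝒟u`, `𝒟u δ_{Ax}`) with the printed block
average `Qu`; the cut-off `Λ_t = Λ₁^{(k)′*}` may depend on the term (it is determined by the term's regions).  File 4 of seat p34 gen 8; the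
field-level / law-level translation is gen 7's `BIJ88Eq531TranslLawCutoff`.

statement-level skeleton of published theorems with citation tags; proofs where landed; nothing here is a claim about the Yang–Mills mass gap

PDF held: `paper:balaban1988-cmp114-bij-abelian-higgs-effective-action` (journal page = PDF page + 256); p. 280 [PDF 24] and p. 297 [PDF 41]
read (`lit read … --pages 21-25`; r16's renders `HOME/lit-balaban-r16/renders/cmp114/original-p024-x2.png`, `original-p041-x2.png`).

CITATION HEADER (lean-in-tree rule).  Part of the lit-balaban TYPED SKELETON (HOME `run/shared/lean/pub/lit-balaban/`), PHASE-2 proof seat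
p34 gen 8 (unit `lit-balaban-p34-g8`; TAKING line HOME/STATUS.md 2026-08-21T19:16:54Z; own lineage = the C1/C2 renormalization-transformation
line; gen 7 hand-off item (a)).  Rows served (support): **`C2.Eq5.3.1-5.3.7`** of `HOME/lit-balaban-r16/ROWS-C2-part2.md` (owner r16; (5.3.1)
`transl531`, (5.3.6)–(5.3.7) p31 `BIJ88Eq536Linearization`, law level gen 7 `BIJ88Eq531TranslLawCutoff`) and `C2.Eq5.9.6` (first line).

THE READING (carriers of record; nothing re-declared).  As `BIJ88Eq531TranslLawCutoff`: `Q` = r18's `qU` ([2] (2.10)), `u·Q^{s*}w` = r18's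
`surfMul u w`, cut-off = p31's `BIJ88Eq536Linearization.cutoff Λ` (`v` on `Λ`, `1` off `Λ`), translated variable
`u′_Λ := surfMul u (cutoff Λ (Qu)⁻¹)` and translation `u = u′_Λ·Q^{s*}(cut-off·v′) = surfMul (surfMul u (cutoff Λ (Qu)⁻¹)) (cutoff Λ v′)` (written
out in every statement, as gen 7 does); `Q` of it is `v′` on `Λ`, `Qu` (`= Q(u′_Λ)`) off `Λ` (gen 7's `qU_translCut`); the configuration space
and display `Fields`, `fieldsMeasure`, `IsRD` of file 1 (`BIJ88RT52Restrictions`).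

WHAT IS TYPED / PROVED, and how.
* §1 `integral_inner_eq_iter` (Fubini for the `({u^{(j)}}, φ, ψ)`-integrals of an integrable function, twice `integral_prod`).
* §2 **`IsRDT ν terms Λ Qu Qφ a ρ ρ̃`** — THE DISPLAY AFTER THE CUT-OFF TRANSLATION: for every bounded measurable test function `g`,
  `∫dv∫dψ ρ̃ g = Σ_t ∫ν(du) ∫dv′ ∫Π𝒟u^{(j)} ∫𝒟φ ∫dψ ρ_t({u^{(j)}}, u′_{Λ_t}·Q^{s*}(cut-off·v′), φ, ψ) · gaussWeight_a(Q_t({u^{(j)}}, u′_{Λ_t}·Q^{s*}(cut-off·v′), φ), ψ)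
  · g((v′ on Λ_t, Qu off Λ_t), ψ)` — the term data are those of `IsRD`; `Λ : terms → cut-offs`.
* §3 **`isRDT_of_isRD`** PROVED: `IsRD ν terms qU Qφ a ρ ρ̃` with `ν` a substitution-invariant probability law (`ν.map (·Q^{s*}w) = ν`) and every
  `ρ_t · gaussWeight_a(Q_t φ, ·)` integrable on `fieldsMeasure ν` IMPLIES `IsRDT ν terms Λ qU Qφ a ρ ρ̃` for ANY cut-offs `Λ_t` (standing range
  `k + 1 ≤ m + K`).  Mechanism, per term: the `({u^{(j)}}, φ, ψ)`-integrals define a `ν`-integrable function of `u` (`Integrable.integral_prod_left`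
  on `fieldsMeasure ν = ν ⊗ (Π𝒟u^{(j)} ⊗ 𝒟φ ⊗ dψ)`); gen 7's `integral_eq_translCut` rewrites its `ν`-integral in the translated variables; the
  iterated form is restored almost everywhere along the measure-preserving translation (`measurePreserving_translCut`,
  `QuasiMeasurePreserving.ae`, `ae_ae_of_ae_prod`); `Q(u′_Λ·Q^{s*}(cut-off·v′))` = `(v′ on Λ, Qu off Λ)` (gen 7's `qU_translCut`) in the test function.
  Instances `isRDT_of_isRD_axial` (`𝒟u δ_{Ax}`, gen 7's `axialMeasure_map_surfMul` — *"δ_{Ax}(u) = δ_{Ax}(u′)"*) and `isRDT_of_isRD_field` (`𝒟u`);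
  for `ψ`-constant data `isRDT_of_isRT511Ax` / after the restrictions of Sect. 5.2 the hypothesis is file 1's (`integrable_weight_mul`).
NOT DONE HERE (honest scope).  The rewriting of the `u′_Λ`-law in the variables `A′` with `δ((e_k/2π)QA′)` (5.3.7) and the Jacobian (p31's
`BIJ88Eq536Linearization` §4, `BIJ88Eq537Jacobian`); the background field after translation (5.3.2)–(5.3.4) (p31 `BIJ88Eq532Torus`/`BIJ88Eq533Torus`);
the choice `Λ = Λ₁^{(k)′*}` from the regions; bounds.  One TYPED display (`IsRDT`, a `def … : Prop` predicate on data in the sense of file 1's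
`IsRD`, discharged here from `IsRD` — not a named fact); theorems otherwise; re-declares nothing; imports Literature + Mathlib only; standard axioms.

v1.1 (append-only, same seat): §4 — **the translated display is EQUIVALENT to the untranslated one** (`isRD_of_isRDT`, `isRD_iff_isRDT`,
instances `_axial`/`_field`: the cut-off translation (5.3.1) is a change of variables, it neither adds nor loses information about `ρ̃`), hence
**`ρ̃` is determined almost everywhere by the translated display, whatever the cut-off family** (`isRDT_unique`: two `dv dψ`-integrable solutions
for cut-off families `Λ`, `Λ′` agree a.e. — *the choice of `Λ₁^{(k)′*}` is immaterial*), `isRDT_congr_ae`; §5 — **(5.2.9) after the operation of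
Sect. 5.3** (*"This restricted gauge invariance we intend to preserve in all subsequent operations"*): `isRDT_blockGauge_axial` — if `ρ̃` satisfies
the translated display over `𝒟u δ_{Ax}` with block-gauge covariant data, so does `(v, ψ) ↦ ρ̃(v^g, gψ)` (through §4 and file 3's
`isRD_blockGauge_axial`).  v1.1 adds the import `BIJ88RT52BlockGauge` (file 3); nothing of v1 is changed.
-/

namespace Literature.MathematicalPhysics.QuantumFieldTheory.BalabanImbrieJaffe1984to88.BIJ88RT53TranslCut

open Literature.MathematicalPhysics.QuantumFieldTheory.Balaban1983to89
open BIJ88Sect3Statements (U1)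
open BIJ85Sect1Model (HiggsField)
open BIJ88RenormTransf311 (axialMeasure gaussWeight)
open BIJ88InductiveForm41 (Prev prevMeasure)
open BIJ88RT51GeneralStep (IsRT511Ax)
open BIJ85BlockAveragesTorus (qU surfMul measurable_qU map_surfMul_fieldMeasure)
open BIJ88Eq536Linearization (cutoff)
open BIJ88Eq531TranslLaw (axialMeasure_map_surfMul)
open BIJ88Eq531TranslLawCutoff (qU_translCut measurable_translCut measurePreserving_translCut integral_eq_translCut)
open BIJ88RT52Restrictions (Fields fieldsMeasure IsRD integral_fieldsMeasure isRT511Ax_iff_isRD integrable_gauss_mul_of_integrable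
  isRD_unique isRD_congr_ae)
open BIJ88RT52BlockGauge (isRD_blockGauge_axial)
open BIJ85RT33 (twist)
open GaugeField (gaugeAct)
open scoped BigOperators ENNReal
open _root_.MeasureTheory _root_.MeasureTheory.Measure Complex Function

noncomputable section

variable {P : Params} {k : ℕ}

/-! ## §1 Fubini for the inner integrals -/

/-- kernel: the iterated `({u^{(j)}}, φ, ψ)`-integrals of a `Π𝒟u^{(j)} ⊗ 𝒟φ ⊗ dψ`-integrable function are its integral (twice `integral_prod`,
almost everywhere at the middle level). [cite: BalabanImbrieJaffe1988, (5.3.1) p.280] -/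
theorem integral_inner_eq_iter {E : Type*} [NormedAddCommGroup E] [NormedSpace ℝ E]
    {h : Prev P k × (HiggsField P k × HiggsField P (k+1)) → E}
    (hh : Integrable h ((prevMeasure P k).prod ((volume : Measure (HiggsField P k)).prod (volume : Measure (HiggsField P (k+1)))))) :
    ∫ r, h r ∂(prevMeasure P k).prod ((volume : Measure (HiggsField P k)).prod (volume : Measure (HiggsField P (k+1)))) =
      ∫ prev, ∫ φ, ∫ ψ, h (prev, (φ, ψ)) ∂volume ∂volume ∂prevMeasure P k := by
  rw [integral_prod _ hh]
  refine integral_congr_ae ?_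
  filter_upwards [hh.prod_right_ae] with prev hprev
  rw [integral_prod _ hprev]

/-! ## §2 The display after the cut-off translation -/

/-- **THE DENSITY DISPLAY AFTER THE FIRST GAUGE FIELD TRANSLATION (5.3.1) WITH CUT-OFF** (the δ-function structure of the first line of
(5.9.6) p. 297, *"∫du^{(k)} δ_{Ax}(u^{(k)}) δ_{Λ₁^{(k)′*c}}(v/Qu^{(k)}) δ_{Λ₁^{(k)′*}}((e_k/2π)QA^{(k)}) …"*, in the push-forward reading): `ρ̃ = ρ̃^L_{k+1}` is a
`(v, ψ)`-density such that for every bounded measurable test function `g`,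
`∫dv∫dψ ρ̃ g = Σ_{t∈terms} ∫ν(du) ∫dv′ ∫Π𝒟u^{(j)} ∫𝒟φ ∫dψ ρ_t({u^{(j)}}, u′_{Λ_t}·Q^{s*}(cut-off_{Λ_t}·v′), φ, ψ) · gaussWeight_a(Q_t(…), ψ) · g((v′ on Λ_t, Qu off Λ_t), ψ)`:
the `u`-field of every term is the translated one, `u = u′_Λ(u)·Q^{s*}(cut-off·v′)` with `u′_Λ = u·Q^{s*}(cut-off·(Qu)⁻¹)`, the `Λ_t`-components
`v′` of the block gauge field are integrated FREELY against the Haar measure `dv′` (*"it removes the v-field from the δ-functions there"*),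
and the block field handed to the test function is `v′` on `Λ_t` and `Qu = Q(u′_Λ)` off `Λ_t` (the surviving `δ_{Λ₁^{(k)′*c}}(v/Qu^{(k)})`).  DATA as
in file 1's `IsRD` plus the cut-offs `Λ : terms → Finset (L-lattice bonds)` (`Λ₁^{(k)′*}` of the term). [cite: BalabanImbrieJaffe1988, (5.3.6) p.280] -/
def IsRDT {ι : Type*} (ν : Measure (GaugeField P k U1)) (terms : Finset ι) (Λ : ι → Finset (PBond P (k+1)))
    (Qu : GaugeField P k U1 → GaugeField P (k+1) U1) (Qφ : ι → Prev P k → GaugeField P k U1 → HiggsField P k → HiggsField P (k+1))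
    (a : ℝ) (ρ : ι → Prev P k → GaugeField P k U1 → HiggsField P k → HiggsField P (k+1) → ℂ)
    (ρL : GaugeField P (k+1) U1 → HiggsField P (k+1) → ℂ) : Prop :=
  ∀ g : GaugeField P (k+1) U1 × HiggsField P (k+1) → ℂ, Measurable g → (∃ C : ℝ, ∀ z, ‖g z‖ ≤ C) →
    ∫ v, ∫ ψ, ρL v ψ * g (v, ψ) ∂volume ∂fieldMeasure P (k+1) U1 =
      ∑ t ∈ terms, ∫ U, ∫ v', ∫ prev, ∫ φ, ∫ ψ,
        ρ t prev (surfMul (surfMul U (cutoff (Λ t) (fun c => (Qu U c)⁻¹))) (cutoff (Λ t) v')) φ ψ *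
          (gaussWeight a (Qφ t prev (surfMul (surfMul U (cutoff (Λ t) (fun c => (Qu U c)⁻¹))) (cutoff (Λ t) v')) φ) ψ : ℂ) *
          g ((fun c => if c ∈ Λ t then v' c else Qu U c), ψ)
        ∂volume ∂volume ∂prevMeasure P k ∂fieldMeasure P (k+1) U1 ∂ν

/-! ## §3 The translation of the display, proved -/

section Transl

variable {ι : Type*} {terms : Finset ι} {ν : Measure (GaugeField P k U1)} [IsProbabilityMeasure ν]
variable {Qφ : ι → Prev P k → GaugeField P k U1 → HiggsField P k → HiggsField P (k+1)} {a : ℝ}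
variable {ρ : ι → Prev P k → GaugeField P k U1 → HiggsField P k → HiggsField P (k+1) → ℂ}
variable {ρL : GaugeField P (k+1) U1 → HiggsField P (k+1) → ℂ}

/-- **ONE TERM AFTER THE CUT-OFF TRANSLATION**: for a substitution-invariant probability law `ν` of `u` and a `fieldsMeasure ν`-integrable full
integrand `H(u, {u^{(j)}}, φ, ψ)`, `∫ν∫Π𝒟u^{(j)}∫𝒟φ∫dψ H(u, ·) = ∫ν(du)∫dv′∫Π𝒟u^{(j)}∫𝒟φ∫dψ H(u′_Λ·Q^{s*}(cut-off·v′), ·)` — gen 7's change of variables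
`integral_eq_translCut` for the `u`-integral of the inner integrals, the iterated form restored almost everywhere along the measure-preserving
translation (standing range). [cite: BalabanImbrieJaffe1988, (5.3.1) p.280] -/
theorem integral_term_translCut (hk : k + 1 ≤ P.m + P.K) (hν : ∀ w, ν.map (fun U => surfMul U w) = ν) (Λ : Finset (PBond P (k+1)))
    {H : Fields P k → ℂ} (hH : Integrable H (fieldsMeasure ν)) :
    ∫ U, ∫ prev, ∫ φ, ∫ ψ, H (U, (prev, (φ, ψ))) ∂volume ∂volume ∂prevMeasure P k ∂ν =
      ∫ U, ∫ v', ∫ prev, ∫ φ, ∫ ψ, H (surfMul (surfMul U (cutoff Λ (fun c => (qU U c)⁻¹))) (cutoff Λ v'), (prev, (φ, ψ)))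
        ∂volume ∂volume ∂prevMeasure P k ∂fieldMeasure P (k+1) U1 ∂ν := by
  -- the inner integrals as one integral over `M = Π𝒟u^{(j)} ⊗ 𝒟φ ⊗ dψ`, a `ν`-integrable function of `u`
  set M : Measure (Prev P k × (HiggsField P k × HiggsField P (k+1))) :=
    (prevMeasure P k).prod ((volume : Measure (HiggsField P k)).prod (volume : Measure (HiggsField P (k+1)))) with hM
  have hH' : Integrable H (ν.prod M) := by simpa only [fieldsMeasure, hM] using hH
  have hF : Integrable (fun U => ∫ r, H (U, r) ∂M) ν := hH'.integral_prod_left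
  -- a.e. in `u`, the `M`-integral is the iterated one
  have hae : ∀ᵐ U ∂ν, Integrable (fun r => H (U, r)) M := hH'.prod_right_ae
  have e1 : ∫ U, ∫ prev, ∫ φ, ∫ ψ, H (U, (prev, (φ, ψ))) ∂volume ∂volume ∂prevMeasure P k ∂ν = ∫ U, ∫ r, H (U, r) ∂M ∂ν := by
    refine integral_congr_ae ?_
    filter_upwards [hae] with U hU
    exact (integral_inner_eq_iter hU).symm
  rw [e1, integral_eq_translCut (Λ := Λ) hk hν hF]
  -- transport the a.e. integrability along the measure-preserving translation, then split the product a.e. statement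
  have hT := measurePreserving_translCut (Λ := Λ) hk hν
  have hae2 : ∀ᵐ p ∂ν.prod (fieldMeasure P (k+1) U1),
      Integrable (fun r => H (surfMul (surfMul p.1 (cutoff Λ (fun c => (qU p.1 c)⁻¹))) (cutoff Λ p.2), r)) M :=
    hT.quasiMeasurePreserving.ae hae
  refine integral_congr_ae ?_
  filter_upwards [ae_ae_of_ae_prod hae2] with U hU
  refine integral_congr_ae ?_
  filter_upwards [hU] with v' hv'
  exact integral_inner_eq_iter hv'

/-- **(5.3.1)/(5.3.6) FOR THE DENSITY DISPLAY, PROVED** — *"The first translation is done in Λ₁^{(k)*}, and it removes the v-field from the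
δ-functions there … δ_{Ax}(u) = δ_{Ax}(u′), δ(v/Qu) = δ_{Λ₁^{(k)′*c}}(v/Qu) δ_{Λ₁^{(k)′*}}((e_k/2π)QA′)"*: if `ρ̃` satisfies file 1's display
`IsRD ν terms Qu Qφ a ρ` for the PRINTED block average `Qu` of [2] (2.10) over a substitution-invariant probability law `ν` of `u`, every term
integrand with its Gaussian factor being `fieldsMeasure ν`-integrable, then `ρ̃` satisfies the translated display `IsRDT ν terms Λ Qu Qφ a ρ` for
ANY family of cut-offs `Λ_t` (standing range).  The `u`-law is untouched (`ν` on both sides: *"δ_{Ax}(u) = δ_{Ax}(u′)"* is the invariance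
`hν`), the `Λ_t`-components of `v` are freed, the others stay tied to `Qu`. [cite: BalabanImbrieJaffe1988, (5.3.6) p.280] -/
theorem isRDT_of_isRD (hk : k + 1 ≤ P.m + P.K) (hν : ∀ w, ν.map (fun U => surfMul U w) = ν)
    (h : IsRD ν terms qU Qφ a ρ ρL)
    (hρi : ∀ t ∈ terms, Integrable
      (fun q : Fields P k => ρ t q.2.1 q.1 q.2.2.1 q.2.2.2 * (gaussWeight a (Qφ t q.2.1 q.1 q.2.2.1) q.2.2.2 : ℂ)) (fieldsMeasure ν))
    (Λ : ι → Finset (PBond P (k+1))) :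
    IsRDT ν terms Λ qU Qφ a ρ ρL := by
  intro g hg hgC
  obtain ⟨C, hC⟩ := hgC
  rw [h g hg ⟨C, hC⟩]
  refine Finset.sum_congr rfl fun t ht => ?_
  -- the full integrand of the term tested against `g`
  set H : Fields P k → ℂ := fun q =>
    ρ t q.2.1 q.1 q.2.2.1 q.2.2.2 * (gaussWeight a (Qφ t q.2.1 q.1 q.2.2.1) q.2.2.2 : ℂ) * g (qU q.1, q.2.2.2) with hHdef
  have hgm : Measurable fun q : Fields P k => g (qU q.1, q.2.2.2) :=
    hg.comp ((measurable_qU.comp measurable_fst).prodMk (measurable_snd.comp (measurable_snd.comp measurable_snd)))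
  have hH : Integrable H (fieldsMeasure ν) :=
    (hρi t ht).mul_bdd hgm.aestronglyMeasurable (Filter.Eventually.of_forall fun q => hC _)
  have key := integral_term_translCut hk hν (Λ t) hH
  simp only [hHdef] at key
  rw [key]
  -- `Q(u′_Λ·Q^{s*}(cut-off·v′))` = `v′` on `Λ`, `Qu` off `Λ`
  simp only [qU_translCut hk]

/-- **Instance `ν = ∫𝒟u δ_{Ax}(u)(·)`** (the measure of (5.1.1)+(5.1.4) and of (5.2.8)): *"δ_{Ax}(u) = δ_{Ax}(u′)"* is gen 7's substitution
invariance `axialMeasure_map_surfMul`; so every density satisfying `IsRD (𝒟u δ_{Ax}) terms Qu Qφ a ρ` with integrable term integrands satisfies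
the translated display for any cut-offs. [cite: BalabanImbrieJaffe1988, (5.3.6) p.280] -/
theorem isRDT_of_isRD_axial (hk : k + 1 ≤ P.m + P.K) (h : IsRD (axialMeasure P k U1) terms qU Qφ a ρ ρL)
    (hρi : ∀ t ∈ terms, Integrable
      (fun q : Fields P k => ρ t q.2.1 q.1 q.2.2.1 q.2.2.2 * (gaussWeight a (Qφ t q.2.1 q.1 q.2.2.1) q.2.2.2 : ℂ))
      (fieldsMeasure (axialMeasure P k U1)))
    (Λ : ι → Finset (PBond P (k+1))) :
    IsRDT (axialMeasure P k U1) terms Λ qU Qφ a ρ ρL :=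
  isRDT_of_isRD hk axialMeasure_map_surfMul h hρi Λ

/-- **Instance `ν = 𝒟u`** (substitution invariance = r18's `map_surfMul_fieldMeasure`). [cite: BalabanImbrieJaffe1988, (5.3.1) p.280] -/
theorem isRDT_of_isRD_field (hk : k + 1 ≤ P.m + P.K) (h : IsRD (fieldMeasure P k U1) terms qU Qφ a ρ ρL)
    (hρi : ∀ t ∈ terms, Integrable
      (fun q : Fields P k => ρ t q.2.1 q.1 q.2.2.1 q.2.2.2 * (gaussWeight a (Qφ t q.2.1 q.1 q.2.2.1) q.2.2.2 : ℂ))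
      (fieldsMeasure (fieldMeasure P k U1)))
    (Λ : ι → Finset (PBond P (k+1))) :
    IsRDT (fieldMeasure P k U1) terms Λ qU Qφ a ρ ρL :=
  isRDT_of_isRD hk map_surfMul_fieldMeasure h hρi Λ

/-- **(5.3.1)/(5.3.6) directly after (5.1.1)+(5.1.4)** (`ψ`-constant data): a density satisfying gen 5's `IsRT511Ax terms Qu Qφ a ρ′` for the
printed `Qu`, with jointly measurable background kernels and jointly measurable `𝒟u δ_{Ax} ⊗ Π𝒟u^{(j)} ⊗ 𝒟φ`-integrable `ρ′_t` (`a > 0`, `d ≥ 2`),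
satisfies the translated display for any cut-offs. [cite: BalabanImbrieJaffe1988, (5.3.6) p.280] -/
theorem isRDT_of_isRT511Ax (hk : k + 1 ≤ P.m + P.K) (ha : 0 < a) (hd : 2 ≤ P.d)
    {ρ' : ι → Prev P k → GaugeField P k U1 → HiggsField P k → ℂ} (h : IsRT511Ax terms qU Qφ a ρ' ρL)
    (hQφ : ∀ t ∈ terms, Measurable fun p : Prev P k × (GaugeField P k U1 × HiggsField P k) => Qφ t p.1 p.2.1 p.2.2)
    (hρm : ∀ t ∈ terms, Measurable fun p : Prev P k × (GaugeField P k U1 × HiggsField P k) => ρ' t p.1 p.2.1 p.2.2)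
    (hρi : ∀ t ∈ terms, Integrable (fun q : GaugeField P k U1 × (Prev P k × HiggsField P k) => ρ' t q.2.1 q.1 q.2.2)
      ((axialMeasure P k U1).prod ((prevMeasure P k).prod volume)))
    (Λ : ι → Finset (PBond P (k+1))) :
    IsRDT (axialMeasure P k U1) terms Λ qU Qφ a (fun t prev U φ _ => ρ' t prev U φ) ρL :=
  isRDT_of_isRD_axial hk ((isRT511Ax_iff_isRD terms qU Qφ a ρ' ρL).1 h)
    (fun t ht => integrable_gauss_mul_of_integrable ha hd (hQφ t ht) (hρm t ht) (hρi t ht)) Λ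

omit [IsProbabilityMeasure ν] in
/-- **Normalization of the translated display** (test `g ≡ 1`). [cite: BalabanImbrieJaffe1988, (5.3.6) p.280] -/
theorem integral_eq_of_isRDT {Qu : GaugeField P k U1 → GaugeField P (k+1) U1} {Λ : ι → Finset (PBond P (k+1))}
    (h : IsRDT ν terms Λ Qu Qφ a ρ ρL) :
    ∫ v, ∫ ψ, ρL v ψ ∂volume ∂fieldMeasure P (k+1) U1 =
      ∑ t ∈ terms, ∫ U, ∫ v', ∫ prev, ∫ φ, ∫ ψ,
        ρ t prev (surfMul (surfMul U (cutoff (Λ t) (fun c => (Qu U c)⁻¹))) (cutoff (Λ t) v')) φ ψ *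
          (gaussWeight a (Qφ t prev (surfMul (surfMul U (cutoff (Λ t) (fun c => (Qu U c)⁻¹))) (cutoff (Λ t) v')) φ) ψ : ℂ)
        ∂volume ∂volume ∂prevMeasure P k ∂fieldMeasure P (k+1) U1 ∂ν := by
  have h1 := h (fun _ => (1 : ℂ)) measurable_const ⟨1, fun _ => by simp⟩
  simp only [mul_one] at h1
  exact h1

end Transl

/-! ## §4 (v1.1) The translated display is equivalent to the untranslated one; uniqueness -/

section Iff

variable {ι : Type*} {terms : Finset ι} {ν : Measure (GaugeField P k U1)} [IsProbabilityMeasure ν]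
variable {Qφ : ι → Prev P k → GaugeField P k U1 → HiggsField P k → HiggsField P (k+1)} {a : ℝ}
variable {ρ : ι → Prev P k → GaugeField P k U1 → HiggsField P k → HiggsField P (k+1) → ℂ}
variable {ρL ρL' : GaugeField P (k+1) U1 → HiggsField P (k+1) → ℂ}

/-- kernel: **one term of the display, tested against a bounded measurable `g`, before and after the cut-off translation** — the two
right-hand sides of `IsRD` and `IsRDT` agree term by term (`integral_term_translCut` for the full integrand, `Q(u′_Λ·Q^{s*}(cut-off·v′)) = (v′ on Λ,
Qu off Λ)`); substitution-invariant probability law `ν`, integrable term integrand, standing range. [cite: BalabanImbrieJaffe1988, (5.3.1) p.280] -/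
theorem term_translCut_test (hk : k + 1 ≤ P.m + P.K) (hν : ∀ w, ν.map (fun U => surfMul U w) = ν) {t : ι}
    (hρi : Integrable
      (fun q : Fields P k => ρ t q.2.1 q.1 q.2.2.1 q.2.2.2 * (gaussWeight a (Qφ t q.2.1 q.1 q.2.2.1) q.2.2.2 : ℂ)) (fieldsMeasure ν))
    (Λ : Finset (PBond P (k+1))) {g : GaugeField P (k+1) U1 × HiggsField P (k+1) → ℂ} (hg : Measurable g) {C : ℝ}
    (hC : ∀ z, ‖g z‖ ≤ C) :
    ∫ U, ∫ prev, ∫ φ, ∫ ψ, ρ t prev U φ ψ * (gaussWeight a (Qφ t prev U φ) ψ : ℂ) * g (qU U, ψ) ∂volume ∂volume ∂prevMeasure P k ∂ν =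
      ∫ U, ∫ v', ∫ prev, ∫ φ, ∫ ψ,
        ρ t prev (surfMul (surfMul U (cutoff Λ (fun c => (qU U c)⁻¹))) (cutoff Λ v')) φ ψ *
          (gaussWeight a (Qφ t prev (surfMul (surfMul U (cutoff Λ (fun c => (qU U c)⁻¹))) (cutoff Λ v')) φ) ψ : ℂ) *
          g ((fun c => if c ∈ Λ then v' c else qU U c), ψ)
        ∂volume ∂volume ∂prevMeasure P k ∂fieldMeasure P (k+1) U1 ∂ν := by
  set H : Fields P k → ℂ := fun q =>
    ρ t q.2.1 q.1 q.2.2.1 q.2.2.2 * (gaussWeight a (Qφ t q.2.1 q.1 q.2.2.1) q.2.2.2 : ℂ) * g (qU q.1, q.2.2.2) with hHdef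
  have hgm : Measurable fun q : Fields P k => g (qU q.1, q.2.2.2) :=
    hg.comp ((measurable_qU.comp measurable_fst).prodMk (measurable_snd.comp (measurable_snd.comp measurable_snd)))
  have hH : Integrable H (fieldsMeasure ν) :=
    hρi.mul_bdd hgm.aestronglyMeasurable (Filter.Eventually.of_forall fun q => hC _)
  have key := integral_term_translCut hk hν Λ hH
  simp only [hHdef] at key
  rw [key]
  simp only [qU_translCut hk]

/-- **The untranslated display from the translated one** (converse of `isRDT_of_isRD`): the translation (5.3.1) with cut-off is a change of
variables under `ν`, so a density satisfying `IsRDT ν terms Λ Qu Qφ a ρ` for SOME cut-off family satisfies file 1's `IsRD ν terms Qu Qφ a ρ`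
(printed `Qu`, substitution-invariant probability law, integrable term integrands, standing range). [cite: BalabanImbrieJaffe1988, (5.3.6) p.280] -/
theorem isRD_of_isRDT (hk : k + 1 ≤ P.m + P.K) (hν : ∀ w, ν.map (fun U => surfMul U w) = ν) {Λ : ι → Finset (PBond P (k+1))}
    (h : IsRDT ν terms Λ qU Qφ a ρ ρL)
    (hρi : ∀ t ∈ terms, Integrable
      (fun q : Fields P k => ρ t q.2.1 q.1 q.2.2.1 q.2.2.2 * (gaussWeight a (Qφ t q.2.1 q.1 q.2.2.1) q.2.2.2 : ℂ)) (fieldsMeasure ν)) :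
    IsRD ν terms qU Qφ a ρ ρL := by
  intro g hg hgC
  obtain ⟨C, hC⟩ := hgC
  rw [h g hg ⟨C, hC⟩]
  exact Finset.sum_congr rfl fun t ht => (term_translCut_test hk hν (hρi t ht) (Λ t) hg hC).symm

/-- **`IsRD ⇔ IsRDT`**: for the printed `Qu` over a substitution-invariant probability law with integrable term integrands, the display of
(5.1.1)/(5.2.8) and its translated form (5.3.1)/(5.3.6) are equivalent characterizations of `ρ̃`, for EVERY cut-off family (standing range).
[cite: BalabanImbrieJaffe1988, (5.3.6) p.280] -/
theorem isRD_iff_isRDT (hk : k + 1 ≤ P.m + P.K) (hν : ∀ w, ν.map (fun U => surfMul U w) = ν)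
    (hρi : ∀ t ∈ terms, Integrable
      (fun q : Fields P k => ρ t q.2.1 q.1 q.2.2.1 q.2.2.2 * (gaussWeight a (Qφ t q.2.1 q.1 q.2.2.1) q.2.2.2 : ℂ)) (fieldsMeasure ν))
    (Λ : ι → Finset (PBond P (k+1))) :
    IsRD ν terms qU Qφ a ρ ρL ↔ IsRDT ν terms Λ qU Qφ a ρ ρL :=
  ⟨fun h => isRDT_of_isRD hk hν h hρi Λ, fun h => isRD_of_isRDT hk hν h hρi⟩

/-- Instance `ν = ∫𝒟u δ_{Ax}(u)(·)`. [cite: BalabanImbrieJaffe1988, (5.3.6) p.280] -/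
theorem isRD_iff_isRDT_axial (hk : k + 1 ≤ P.m + P.K)
    (hρi : ∀ t ∈ terms, Integrable
      (fun q : Fields P k => ρ t q.2.1 q.1 q.2.2.1 q.2.2.2 * (gaussWeight a (Qφ t q.2.1 q.1 q.2.2.1) q.2.2.2 : ℂ))
      (fieldsMeasure (axialMeasure P k U1)))
    (Λ : ι → Finset (PBond P (k+1))) :
    IsRD (axialMeasure P k U1) terms qU Qφ a ρ ρL ↔ IsRDT (axialMeasure P k U1) terms Λ qU Qφ a ρ ρL :=
  isRD_iff_isRDT hk axialMeasure_map_surfMul hρi Λ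

/-- Instance `ν = 𝒟u`. [cite: BalabanImbrieJaffe1988, (5.3.1) p.280] -/
theorem isRD_iff_isRDT_field (hk : k + 1 ≤ P.m + P.K)
    (hρi : ∀ t ∈ terms, Integrable
      (fun q : Fields P k => ρ t q.2.1 q.1 q.2.2.1 q.2.2.2 * (gaussWeight a (Qφ t q.2.1 q.1 q.2.2.1) q.2.2.2 : ℂ))
      (fieldsMeasure (fieldMeasure P k U1)))
    (Λ : ι → Finset (PBond P (k+1))) :
    IsRD (fieldMeasure P k U1) terms qU Qφ a ρ ρL ↔ IsRDT (fieldMeasure P k U1) terms Λ qU Qφ a ρ ρL :=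
  isRD_iff_isRDT hk map_surfMul_fieldMeasure hρi Λ

/-- **The translated display determines `ρ̃` almost everywhere — whatever the cut-offs**: two `dv dψ`-integrable densities satisfying the
translated display for the same data and possibly DIFFERENT cut-off families `Λ`, `Λ′` agree `dv dψ`-a.e. (through §4 and file 1's
`isRD_unique`): the choice of the regions `Λ₁^{(k)′*}` in (5.3.1) does not affect the density. [cite: BalabanImbrieJaffe1988, (5.3.6) p.280] -/
theorem isRDT_unique (hk : k + 1 ≤ P.m + P.K) (hν : ∀ w, ν.map (fun U => surfMul U w) = ν) {Λ Λ' : ι → Finset (PBond P (k+1))}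
    (hρi : ∀ t ∈ terms, Integrable
      (fun q : Fields P k => ρ t q.2.1 q.1 q.2.2.1 q.2.2.2 * (gaussWeight a (Qφ t q.2.1 q.1 q.2.2.1) q.2.2.2 : ℂ)) (fieldsMeasure ν))
    (h : IsRDT ν terms Λ qU Qφ a ρ ρL) (h' : IsRDT ν terms Λ' qU Qφ a ρ ρL')
    (hi : Integrable (uncurry ρL) ((fieldMeasure P (k+1) U1).prod volume))
    (hi' : Integrable (uncurry ρL') ((fieldMeasure P (k+1) U1).prod volume)) :
    uncurry ρL =ᵐ[(fieldMeasure P (k+1) U1).prod volume] uncurry ρL' :=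
  isRD_unique (isRD_of_isRDT hk hν h hρi) (isRD_of_isRDT hk hν h' hρi) hi hi'

omit [IsProbabilityMeasure ν] in
/-- A `dv dψ`-integrable function almost everywhere equal to an integrable solution of the translated display is again a solution (file 1's
`integral_test_congr_ae`; any `Qu`, any `ν`). [cite: BalabanImbrieJaffe1988, (5.3.6) p.280] -/
theorem isRDT_congr_ae {Qu : GaugeField P k U1 → GaugeField P (k+1) U1} {Λ : ι → Finset (PBond P (k+1))}
    (h : IsRDT ν terms Λ Qu Qφ a ρ ρL)
    (hi : Integrable (uncurry ρL) ((fieldMeasure P (k+1) U1).prod volume))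
    (hi' : Integrable (uncurry ρL') ((fieldMeasure P (k+1) U1).prod volume))
    (hae : uncurry ρL' =ᵐ[(fieldMeasure P (k+1) U1).prod volume] uncurry ρL) :
    IsRDT ν terms Λ Qu Qφ a ρ ρL' := fun g hg hb => by
  rw [BIJ88RT51Unique.integral_test_congr_ae hi hi' hae hg hb]
  exact h g hg hb

end Iff

/-! ## §5 (v1.1) (5.2.9) after the operation of Sect. 5.3 -/

section BlockGauge

variable {ι : Type*} {terms : Finset ι}
variable {Qφ : ι → Prev P k → GaugeField P k U1 → HiggsField P k → HiggsField P (k+1)} {a : ℝ}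
variable {ρ : ι → Prev P k → GaugeField P k U1 → HiggsField P k → HiggsField P (k+1) → ℂ}
variable {ρL : GaugeField P (k+1) U1 → HiggsField P (k+1) → ℂ}

/-- **(5.2.9) IS PRESERVED BY THE TRANSLATION STEP (5.3.1)/(5.3.6)** p. 279 [PDF 23]: *"This restricted gauge invariance we intend to preserve in
all subsequent operations"* — for the operation of Sect. 5.3, at measure level: if `ρ̃` satisfies the translated display over `∫𝒟u δ_{Ax}(u)(·)`
with the printed `Qu` (covariant: r18's `qU_gaugeAct_blockConst`), integrable term integrands, and for every term and `g` a `Π𝒟u^{(j)}`-preserving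
reparametrization `τ_t(g)` under which `ρ_t` is invariant and `Q_t` covariant (jointly with `u ↦ u^{g∘y}`, `φ ↦ (g∘y)φ`, `ψ ↦ gψ`), then `(v, ψ) ↦
ρ̃(v^g, gψ)` satisfies the same translated display (§4 + file 3's `isRD_blockGauge_axial`; standing range). [cite: BalabanImbrieJaffe1988, (5.2.9) p.279] -/
theorem isRDT_blockGauge_axial (hk : k + 1 ≤ P.m + P.K) {Λ : ι → Finset (PBond P (k+1))}
    (hρi : ∀ t ∈ terms, Integrable
      (fun q : Fields P k => ρ t q.2.1 q.1 q.2.2.1 q.2.2.2 * (gaussWeight a (Qφ t q.2.1 q.1 q.2.2.1) q.2.2.2 : ℂ))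
      (fieldsMeasure (axialMeasure P k U1)))
    (τ : ι → GaugeTransf P (k+1) U1 → Prev P k ≃ᵐ Prev P k)
    (hτ : ∀ t ∈ terms, ∀ g, MeasurePreserving (τ t g) (prevMeasure P k) (prevMeasure P k))
    (hρ : ∀ t ∈ terms, ∀ (g : GaugeTransf P (k+1) U1) prev U φ ψ,
      ρ t (τ t g prev) (gaugeAct (fun x => g (blockOf x)) U) (twist (fun x => g (blockOf x)) φ) (twist g ψ) = ρ t prev U φ ψ)
    (hQφ : ∀ t ∈ terms, ∀ (g : GaugeTransf P (k+1) U1) prev U φ,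
      Qφ t (τ t g prev) (gaugeAct (fun x => g (blockOf x)) U) (twist (fun x => g (blockOf x)) φ) = twist g (Qφ t prev U φ))
    (h : IsRDT (axialMeasure P k U1) terms Λ qU Qφ a ρ ρL) (g : GaugeTransf P (k+1) U1) :
    IsRDT (axialMeasure P k U1) terms Λ qU Qφ a ρ (fun v ψ => ρL (gaugeAct g v) (twist g ψ)) :=
  (isRD_iff_isRDT_axial hk hρi Λ).1
    (isRD_blockGauge_axial hk (fun g U => BIJ88BlockGauge417.qU_gaugeAct_blockConst hk g U) τ hτ hρ hQφ
      ((isRD_iff_isRDT_axial hk hρi Λ).2 h) g)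

end BlockGauge

end

end Literature.MathematicalPhysics.QuantumFieldTheory.BalabanImbrieJaffe1984to88.BIJ88RT53TranslCut
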